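import Literature.NumberTheory.ModularForms.PoincareSeriesWeightTwoHecke
import Literature.NumberTheory.LFunctions.WeightTwoBesselModeIntegral
import HarnessLib

/-!
# The cell integral of the weight-2 Poincaré series at `s = 0` is the Kloosterman–Bessel term

Topic `Literature/NumberTheory/ModularForms` (namespace `Literature.NumberTheory.ModularForms.PoincareWeightTwo`,
continuing `PoincareSeriesWeightTwoHecke.lean`). THEOREMS ONLY. The cell integral
`modeIntegral s A B y = ∫_ℝ (t+iy)⁻² |t+iy|^{−2s} e(−A/(t+iy)) e(−Bt) dt` of the Fourier expansion of
the Hecke-regularised Poincaré series (Iwaniec–Kowalski §14.2, proof of Lemma 14.2), at `s = 0` and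
`A, B, y > 0`, equals `e^{−2πBy} · (−2π √(B/A) J₁(4π√(AB)))` — the tree's Lipschitz–Hankel evaluation
`weightTwo_besselModeIntegral` (stub S2 of the I1 skeleton, landed) after pulling out the factor
`e(−B·iy) = e^{−2πBy}`. This is the `s = 0` endpoint used by stub T3 (`stub_heckeLimit`) of the I1 fact
skeleton `Summits/Parity/GeneralizedHardyLittlewood/Cruxes/PeterssonBoundPrinted/Lines/poincare_hecke.lean`.

* `modeIntegral_zero_eq` — `modeIntegral 0 A B y = e^{−2πBy} · (−2π √(B/A) J₁(4π√(AB)))`.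

## References

* [IwaniecKowalski2004] H. Iwaniec, E. Kowalski, *Analytic Number Theory*, §14.2 (proof of Lemma 14.2).
-/

noncomputable section

open scoped Real
open Complex MeasureTheory
open Literature.Analysis.FunctionSpaces (besselJ)

namespace Literature.NumberTheory.ModularForms.PoincareWeightTwo

/-- **The cell integral at `s = 0`:** for `A, B, y > 0`,
`modeIntegral 0 A B y = e^{−2πBy} · (−2π √(B/A) J₁(4π√(AB)))` (the landed Lipschitz–Hankel evaluation
`weightTwo_besselModeIntegral`, whose integrand carries `e(−B(t+iy)) = e^{2πBy} e(−Bt)`).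
[cite: IwaniecKowalski2004, §14.2 (proof of Lemma 14.2)] -/
theorem modeIntegral_zero_eq {A B y : ℝ} (hA : 0 < A) (hB : 0 < B) (hy : 0 < y) :
    modeIntegral 0 A B y =
      ((Real.exp (-(2 * π * B * y)) : ℝ) : ℂ) *
        ((-(2 * π * Real.sqrt (B / A) * besselJ 1 (4 * π * Real.sqrt (A * B))) : ℝ) : ℂ) := by
  rw [← Literature.NumberTheory.LFunctions.weightTwo_besselModeIntegral A B y hA hB hy,
    ← integral_const_mul]
  unfold modeIntegral
  refine integral_congr_ae (ae_of_all _ fun t ↦ ?_)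
  simp only [mul_zero, neg_zero, Real.rpow_zero, Complex.ofReal_one, mul_one]
  -- `e(−A/τ − Bt) = e^{−2πBy} · e(−A/τ − Bτ)` with `τ = t + iy`
  have hexp : cexp (2 * π * I * (-(A : ℂ) / ((t : ℂ) + y * I) - B * t)) =
      ((Real.exp (-(2 * π * B * y)) : ℝ) : ℂ) *
        cexp (2 * π * I * (-(A : ℂ) / ((t : ℂ) + y * I) - B * ((t : ℂ) + y * I))) := by
    rw [Complex.ofReal_exp, ← Complex.exp_add]
    congr 1
    push_cast
    ring_nf
    rw [Complex.I_sq]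
    ring
  rw [hexp]
  ring

end Literature.NumberTheory.ModularForms.PoincareWeightTwo

end
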